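import Summits.Ventures.DiscreteObjects.Hadamard.ElemAbelianPTools
import Summits.Ventures.DiscreteObjects.Hadamard.ElemAbelianLines

/-!
# Hadamard 668 census, family F12 — rank-2 elementary abelian groups: the CYCLE bound and the fixed-column count
# (kernel tools, general odd prime `p`)

Framing: lottery ticket; floor = certified bounds/negative ranges.

Cell pub-namedobj (venture DiscreteObjects), target (H), hadamard gen 17.  The heart of `ElemAbelianRank2_11`
(gen 16, `p = 11`, one 350-line proof under raised heartbeats) extracted as lemmas for a GENERAL odd prime `p`, so that
`p = 7` (`ElemAbelianRank2_7`) and a lint-free `p = 11` can share them.  Setting: two signed-permutation automorphisms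
`(α, α', d₁, e₁)`, `(β, β', d₂, e₂)` of a Hadamard matrix `H` of order `n`, `α^p = α'^p = β^p = β'^p = 1`, commuting
permutation parts; `g = (a,b) ∈ (ℤ/p)²` acts by `α^a β^b` on rows and `α'^a β'^b` on columns; `R` = the `p + 1` standard
line representatives of `ElemAbelianLines`.
* PURE COUNTING (one commuting pair `α, β` of exponent `p`; `g, h ≠ 1`, `h` off the line of `g`; `D :=` points fixed
  by `g` and `h`): `D` is fixed by everything and two distinct representatives fix only `D` in common
  (`rank2_reps_fix_inter`); `|D| ≤ #Fix(r)` and `#Fix(r) ≡ |D| (mod p)` (`rank2_card_fixed_mod`); and for any `rK ∈ R`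
  **`|⋃_{r ∈ R ∖ rK} Fix(r)| = |D| + Σ_{r ∈ R ∖ rK} (#Fix(r) − |D|)`** (`rank2_card_biUnion_fixed`).
* **CYCLE BOUND** (`rank2_cycle_bound`): if a row `x₀` is fixed by `g ≠ 1` (on the line of `rK ∈ R`) and moved by
  `h ≠ 1`, then `p · |⋃_{r ∈ R ∖ rK} Fix_cols(r)| ≤ n`.  Proof verbatim from gen 16: the `h`-cycle `B` of `x₀`
  (`p` rows) is invariant under the group (generation `exists_pow_mul_pow`) and every element moving `x₀` is
  fixed-point-free hence transitive on it; after re-signing w.r.t. `h` (`exists_resign_of_odd`) every element's row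
  signs commute with `h` exactly (`signedAut_comm_of_odd`), so each column fixed by an element moving `x₀` is CONSTANT
  along `B`, and `|B|·|T| ≤ n` (`card_mul_card_le_of_const_cols`).
Ours, not literature; no `sorry`; default heartbeats.
-/

namespace Summit.Ventures.DiscreteObjects.Hadamard

open Finset BigOperators

open Literature.Combinatorics.Designs.GoethalsSeidel (IsHadamardMatrix)

variable {ι : Type*} [Fintype ι] [DecidableEq ι]

section counting
variable (p : ℕ) [hp : Fact p.Prime] (α β : Equiv.Perm ι)

/-- the standard representatives are `≠ 1` -/
lemma lineRep_ne_one {r : Multiplicative (ZMod p × ZMod p)}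
    (hr : r ∈ insert (Multiplicative.ofAdd ((0 : ZMod p), (1 : ZMod p)))
        ((univ : Finset (ZMod p)).image (fun t => Multiplicative.ofAdd ((1 : ZMod p), t)))) : r ≠ 1 := by
  intro h1
  rw [Finset.mem_insert, Finset.mem_image] at hr
  rcases hr with rfl | ⟨t, -, rfl⟩
  · have := congrArg (fun x => (Multiplicative.toAdd x).2) h1
    simp at this
  · have := congrArg (fun x => (Multiplicative.toAdd x).1) h1
    simp at this

/-- for every representative there is another one -/
lemma exists_lineRep_ne (r : Multiplicative (ZMod p × ZMod p)) :
    ∃ s ∈ insert (Multiplicative.ofAdd ((0 : ZMod p), (1 : ZMod p)))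
        ((univ : Finset (ZMod p)).image (fun t => Multiplicative.ofAdd ((1 : ZMod p), t))), r ≠ s := by
  by_cases hr0 : r = Multiplicative.ofAdd ((0 : ZMod p), (1 : ZMod p))
  · refine ⟨Multiplicative.ofAdd ((1 : ZMod p), (0 : ZMod p)),
      Finset.mem_insert_of_mem (Finset.mem_image.mpr ⟨0, Finset.mem_univ _, rfl⟩), ?_⟩
    rw [hr0]; intro h01
    have := congrArg (fun x => (Multiplicative.toAdd x).1) h01
    simp at this
  · exact ⟨_, Finset.mem_insert_self _ _, hr0⟩

/-- **two distinct representatives fix only what everything fixes**: a point fixed by two distinct representatives is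
fixed by any `g` and `h`. -/
lemma rank2_reps_fix_inter (hα : α ^ p = 1) (hβ : β ^ p = 1) (hc : Commute α β)
    (g h : Multiplicative (ZMod p × ZMod p)) {r r' : Multiplicative (ZMod p × ZMod p)}
    (hr : r ∈ insert (Multiplicative.ofAdd ((0 : ZMod p), (1 : ZMod p)))
        ((univ : Finset (ZMod p)).image (fun t => Multiplicative.ofAdd ((1 : ZMod p), t))))
    (hr' : r' ∈ insert (Multiplicative.ofAdd ((0 : ZMod p), (1 : ZMod p)))
        ((univ : Finset (ZMod p)).image (fun t => Multiplicative.ofAdd ((1 : ZMod p), t))))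
    (hrr' : r ≠ r') {y : ι}
    (hy : (α ^ (Multiplicative.toAdd r).1.val * β ^ (Multiplicative.toAdd r).2.val) y = y)
    (hy' : (α ^ (Multiplicative.toAdd r').1.val * β ^ (Multiplicative.toAdd r').2.val) y = y) :
    y ∈ univ.filter (fun y =>
      (α ^ (Multiplicative.toAdd g).1.val * β ^ (Multiplicative.toAdd g).2.val) y = y ∧
      (α ^ (Multiplicative.toAdd h).1.val * β ^ (Multiplicative.toAdd h).2.val) y = y) := by
  have hall := fixed_by_all_of_two p α β hα hβ hc {y} (lineRep_ne_one p hr) (lineRep_ne_one p hr')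
    (rep_not_mem_pline_rep p hr hr' hrr')
    (fun j hj => by rw [Finset.mem_singleton] at hj; rw [hj]; exact hy)
    (fun j hj => by rw [Finset.mem_singleton] at hj; rw [hj]; exact hy')
  rw [Finset.mem_filter]
  exact ⟨Finset.mem_univ _, hall g y (Finset.mem_singleton_self _), hall h y (Finset.mem_singleton_self _)⟩

/-- **`|D| ≤ #Fix(u)` and `#Fix(r) ≡ |D| (mod p)`** for every representative `r` (and `D` as above). -/
lemma rank2_card_fixed_mod (hα : α ^ p = 1) (hβ : β ^ p = 1) (hc : Commute α β)
    {g h : Multiplicative (ZMod p × ZMod p)} (hg : g ≠ 1) (hh : h ≠ 1)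
    (hgh : h ∉ (Finset.range (p - 1)).image (fun k => g ^ (k + 1)))
    {r : Multiplicative (ZMod p × ZMod p)}
    (hr : r ∈ insert (Multiplicative.ofAdd ((0 : ZMod p), (1 : ZMod p)))
        ((univ : Finset (ZMod p)).image (fun t => Multiplicative.ofAdd ((1 : ZMod p), t)))) :
    (univ.filter (fun y =>
      (α ^ (Multiplicative.toAdd g).1.val * β ^ (Multiplicative.toAdd g).2.val) y = y ∧
      (α ^ (Multiplicative.toAdd h).1.val * β ^ (Multiplicative.toAdd h).2.val) y = y)).card ≤
      (univ.filter fun y => (α ^ (Multiplicative.toAdd r).1.val * β ^ (Multiplicative.toAdd r).2.val) y = y).card ∧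
    (univ.filter fun y => (α ^ (Multiplicative.toAdd r).1.val * β ^ (Multiplicative.toAdd r).2.val) y = y).card % p =
      (univ.filter (fun y =>
        (α ^ (Multiplicative.toAdd g).1.val * β ^ (Multiplicative.toAdd g).2.val) y = y ∧
        (α ^ (Multiplicative.toAdd h).1.val * β ^ (Multiplicative.toAdd h).2.val) y = y)).card % p := by
  classical
  set σ : Multiplicative (ZMod p × ZMod p) → Equiv.Perm ι :=
    fun g => α ^ (Multiplicative.toAdd g).1.val * β ^ (Multiplicative.toAdd g).2.val with hσ
  set D := univ.filter (fun y => σ g y = y ∧ σ h y = y) with hDdef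
  have hDall : ∀ u, ∀ y ∈ D, σ u y = y := by
    intro u
    exact fixed_by_all_of_two p α β hα hβ hc D hg hh hgh
      (fun y hy => ((Finset.mem_filter.mp hy).2).1) (fun y hy => ((Finset.mem_filter.mp hy).2).2) u
  have hDsub : ∀ u, D ⊆ univ.filter (fun y => σ u y = y) := by
    intro u y hy
    simp only [Finset.mem_filter, Finset.mem_univ, true_and]
    exact hDall u y hy
  refine ⟨Finset.card_le_card (hDsub r), ?_⟩
  obtain ⟨s₁, hs₁, hrs₁⟩ := exists_lineRep_ne p r
  set F := univ.filter (fun y => σ r y = y) with hFdef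
  have hcomm : Commute (σ r) (σ s₁) := pairPerm_commute p α β hα hβ hc r s₁
  have hFinv : ∀ y, y ∈ F ↔ σ s₁ y ∈ F := by
    intro y
    simp only [hFdef, Finset.mem_filter, Finset.mem_univ, true_and]
    have hcm : σ r (σ s₁ y) = σ s₁ (σ r y) := by
      have := congrArg (fun π => π y) hcomm.eq
      simpa [Equiv.Perm.mul_apply] using this
    rw [hcm]
    constructor
    · intro h0; rw [h0]
    · intro h0; exact (σ s₁).injective h0
  have hm := card_filter_fixed_mod_prime p hp.out (σ s₁) (pairPerm_pow_p p α β hα hβ hc s₁) F hFinv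
  have hFD : F.filter (fun y => σ s₁ y = y) = D := by
    ext y
    simp only [hFdef, Finset.mem_filter, Finset.mem_univ, true_and]
    constructor
    · rintro ⟨h1, h2⟩
      exact rank2_reps_fix_inter p α β hα hβ hc g h hr hs₁ hrs₁ h1 h2
    · intro hy; exact ⟨hDall r y hy, hDall s₁ y hy⟩
  rw [hFD] at hm
  exact hm.symm

/-- **the union of the fixed sets of all representatives but one**: for `rK ∈ R`,
`|⋃_{r ∈ R ∖ rK} Fix(r)| = |D| + Σ_{r ∈ R ∖ rK} (#Fix(r) − |D|)`. -/
lemma rank2_card_biUnion_fixed (hα : α ^ p = 1) (hβ : β ^ p = 1) (hc : Commute α β)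
    {g h : Multiplicative (ZMod p × ZMod p)} (hg : g ≠ 1) (hh : h ≠ 1)
    (hgh : h ∉ (Finset.range (p - 1)).image (fun k => g ^ (k + 1)))
    {rK : Multiplicative (ZMod p × ZMod p)}
    (hrK : rK ∈ insert (Multiplicative.ofAdd ((0 : ZMod p), (1 : ZMod p)))
        ((univ : Finset (ZMod p)).image (fun t => Multiplicative.ofAdd ((1 : ZMod p), t)))) :
    (((insert (Multiplicative.ofAdd ((0 : ZMod p), (1 : ZMod p)))
        ((univ : Finset (ZMod p)).image (fun t => Multiplicative.ofAdd ((1 : ZMod p), t)))).erase rK).biUnion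
        (fun r => univ.filter fun y =>
          (α ^ (Multiplicative.toAdd r).1.val * β ^ (Multiplicative.toAdd r).2.val) y = y)).card =
      (univ.filter (fun y =>
        (α ^ (Multiplicative.toAdd g).1.val * β ^ (Multiplicative.toAdd g).2.val) y = y ∧
        (α ^ (Multiplicative.toAdd h).1.val * β ^ (Multiplicative.toAdd h).2.val) y = y)).card +
      ∑ r ∈ (insert (Multiplicative.ofAdd ((0 : ZMod p), (1 : ZMod p)))
        ((univ : Finset (ZMod p)).image (fun t => Multiplicative.ofAdd ((1 : ZMod p), t)))).erase rK,
        ((univ.filter fun y =>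
          (α ^ (Multiplicative.toAdd r).1.val * β ^ (Multiplicative.toAdd r).2.val) y = y).card -
        (univ.filter (fun y =>
          (α ^ (Multiplicative.toAdd g).1.val * β ^ (Multiplicative.toAdd g).2.val) y = y ∧
          (α ^ (Multiplicative.toAdd h).1.val * β ^ (Multiplicative.toAdd h).2.val) y = y)).card) := by
  classical
  set σ : Multiplicative (ZMod p × ZMod p) → Equiv.Perm ι :=
    fun g => α ^ (Multiplicative.toAdd g).1.val * β ^ (Multiplicative.toAdd g).2.val with hσ
  set R := insert (Multiplicative.ofAdd ((0 : ZMod p), (1 : ZMod p)))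
    ((univ : Finset (ZMod p)).image (fun t => Multiplicative.ofAdd ((1 : ZMod p), t))) with hR
  set D := univ.filter (fun y => σ g y = y ∧ σ h y = y) with hDdef
  set T := (R.erase rK).biUnion (fun r => univ.filter (fun y => σ r y = y)) with hTdef
  have hDall : ∀ u, ∀ y ∈ D, σ u y = y := by
    intro u
    exact fixed_by_all_of_two p α β hα hβ hc D hg hh hgh
      (fun y hy => ((Finset.mem_filter.mp hy).2).1) (fun y hy => ((Finset.mem_filter.mp hy).2).2) u
  have hDsub : ∀ u, D ⊆ univ.filter (fun y => σ u y = y) := by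
    intro u y hy
    simp only [Finset.mem_filter, Finset.mem_univ, true_and]
    exact hDall u y hy
  have hRcard : R.card = p + 1 := card_lineReps p
  have hRKcard : (R.erase rK).card = p := by rw [Finset.card_erase_of_mem hrK, hRcard]; rfl
  obtain ⟨r₁, hr₁⟩ : (R.erase rK).Nonempty := by rw [← Finset.card_pos, hRKcard]; exact hp.out.pos
  have hDT : D ⊆ T := by
    intro y hy
    rw [hTdef, Finset.mem_biUnion]
    exact ⟨r₁, hr₁, hDsub r₁ hy⟩
  have hTD : T \ D = (R.erase rK).biUnion (fun r => univ.filter (fun y => σ r y = y) \ D) := by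
    ext y
    simp only [hTdef, Finset.mem_sdiff, Finset.mem_biUnion]
    constructor
    · rintro ⟨⟨r, hr, hyr⟩, hyD⟩; exact ⟨r, hr, hyr, hyD⟩
    · rintro ⟨r, hr, hyr, hyD⟩; exact ⟨⟨r, hr, hyr⟩, hyD⟩
  have hdisj : ((R.erase rK : Finset _) : Set (Multiplicative (ZMod p × ZMod p))).PairwiseDisjoint
      (fun r => univ.filter (fun y => σ r y = y) \ D) := by
    intro r hr r' hr' hrr'
    rw [Function.onFun, Finset.disjoint_left]
    intro y hy hy'
    rw [Finset.mem_sdiff, Finset.mem_filter] at hy hy'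
    have hrR := (Finset.mem_erase.mp hr).2
    have hr'R := (Finset.mem_erase.mp hr').2
    exact hy.2 (rank2_reps_fix_inter p α β hα hβ hc g h hrR hr'R hrr' hy.1.2 hy'.1.2)
  have h1 : (T \ D).card = ∑ r ∈ R.erase rK, ((univ.filter (fun y => σ r y = y)).card - D.card) := by
    rw [hTD, Finset.card_biUnion hdisj]
    apply Finset.sum_congr rfl
    intro r _
    rw [Finset.card_sdiff_of_subset (hDsub r)]
  rw [← Finset.card_sdiff_add_card_eq_card hDT, h1, add_comm]

end counting

section hadamard
variable (p : ℕ) [hp : Fact p.Prime]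

/-- **cycle bound.**  If a row `x₀` is fixed by `g ≠ 1`, `g` on the line of the representative `rK`, and moved by
`h ≠ 1`, then `p · |⋃_{r ∈ R ∖ rK} Fix_cols(r)| ≤ n`. -/
theorem rank2_cycle_bound {H : Matrix ι ι ℤ} (hH : IsHadamardMatrix H) (hodd : Odd p)
    {α α' β β' : Equiv.Perm ι} {d₁ e₁ d₂ e₂ : ι → ℤ}
    (hA : IsSignedAut H α α' d₁ e₁) (hB : IsSignedAut H β β' d₂ e₂)
    (hα : α ^ p = 1) (hα' : α' ^ p = 1) (hβ : β ^ p = 1) (hβ' : β' ^ p = 1)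
    (hc : Commute α β) (hc' : Commute α' β')
    {g h rK : Multiplicative (ZMod p × ZMod p)} (hg : g ≠ 1) (hh : h ≠ 1) {x₀ : ι}
    (hgx : (α ^ (Multiplicative.toAdd g).1.val * β ^ (Multiplicative.toAdd g).2.val) x₀ = x₀)
    (hhx : (α ^ (Multiplicative.toAdd h).1.val * β ^ (Multiplicative.toAdd h).2.val) x₀ ≠ x₀)
    (hrK : rK ∈ insert (Multiplicative.ofAdd ((0 : ZMod p), (1 : ZMod p)))
        ((univ : Finset (ZMod p)).image (fun t => Multiplicative.ofAdd ((1 : ZMod p), t))))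
    (hgline : g ∈ (Finset.range (p - 1)).image (fun k => rK ^ (k + 1))) :
    p * (((insert (Multiplicative.ofAdd ((0 : ZMod p), (1 : ZMod p)))
        ((univ : Finset (ZMod p)).image (fun t => Multiplicative.ofAdd ((1 : ZMod p), t)))).erase rK).biUnion
        (fun r => univ.filter fun y =>
          (α' ^ (Multiplicative.toAdd r).1.val * β' ^ (Multiplicative.toAdd r).2.val) y = y)).card ≤
      Fintype.card ι := by
  classical
  set σ : Multiplicative (ZMod p × ZMod p) → Equiv.Perm ι :=
    fun g => α ^ (Multiplicative.toAdd g).1.val * β ^ (Multiplicative.toAdd g).2.val with hσ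
  set σ' : Multiplicative (ZMod p × ZMod p) → Equiv.Perm ι :=
    fun g => α' ^ (Multiplicative.toAdd g).1.val * β' ^ (Multiplicative.toAdd g).2.val with hσ'
  set R := insert (Multiplicative.ofAdd ((0 : ZMod p), (1 : ZMod p)))
    ((univ : Finset (ZMod p)).image (fun t => Multiplicative.ofAdd ((1 : ZMod p), t))) with hR
  have hp0 : 0 < p := hp.out.pos
  have hσp : ∀ g, σ g ^ p = 1 := fun g => pairPerm_pow_p p α β hα hβ hc g
  have hσ'p : ∀ g, σ' g ^ p = 1 := fun g => pairPerm_pow_p p α' β' hα' hβ' hc' g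
  have hσcomm : ∀ g h, Commute (σ g) (σ h) := fun g h => pairPerm_commute p α β hα hβ hc g h
  have hσ'comm : ∀ g h, Commute (σ' g) (σ' h) := fun g h => pairPerm_commute p α' β' hα' hβ' hc' g h
  have hσmul : ∀ g h, σ (g * h) = σ g * σ h := fun g h => pairPerm_mul p α β hα hβ hc g h
  have hσpow : ∀ g (k : ℕ), σ (g ^ k) = σ g ^ k := fun g k => pairPerm_pow p α β hα hβ hc g k
  have haut : ∀ g, ∃ d e : ι → ℤ, IsSignedAut H (σ g) (σ' g) d e := fun g => isSignedAut_pair p hA hB g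
  have hgx' : σ g x₀ = x₀ := hgx; have hhx' : σ h x₀ ≠ x₀ := hhx
  have hgxpow : ∀ n : ℕ, (σ g ^ n) x₀ = x₀ := by
    intro n; induction n with
    | zero => simp
    | succ n ih => rw [pow_succ, Equiv.Perm.mul_apply, hgx', ih]
  have hgh : h ∉ (Finset.range (p - 1)).image (fun k => g ^ (k + 1)) := by
    rw [mem_pline_iff]
    rintro ⟨k, -, rfl⟩
    apply hhx'
    rw [hσpow]
    exact hgxpow (k + 1)
  -- Step 2: the h-cycle B of x₀
  set B := (Finset.range p).image (fun k => (σ h ^ k) x₀) with hBdef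
  have hx₀B : x₀ ∈ B := Finset.mem_image.mpr ⟨0, Finset.mem_range.mpr hp0, by simp⟩
  have hBcard : B.card = p := by
    rw [hBdef, Finset.card_image_of_injOn, Finset.card_range]
    intro k hk l hl hkl
    simp only [Finset.coe_range, Set.mem_Iio] at hk hl
    simp only at hkl
    by_contra hne
    rcases Nat.lt_or_gt_of_ne hne with hlt | hlt
    · have e : (σ h ^ k) ((σ h ^ (l - k)) x₀) = (σ h ^ k) x₀ := by
        rw [← Equiv.Perm.mul_apply, ← pow_add, show k + (l - k) = l by omega]; exact hkl.symm
      exact hhx' (fixed_of_pow_fixed p (σ h) (hσp h) (by omega) (by omega) ((σ h ^ k).injective e))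
    · have e : (σ h ^ l) ((σ h ^ (k - l)) x₀) = (σ h ^ l) x₀ := by
        rw [← Equiv.Perm.mul_apply, ← pow_add, show l + (k - l) = k by omega]; exact hkl
      exact hhx' (fixed_of_pow_fixed p (σ h) (hσp h) (by omega) (by omega) ((σ h ^ l).injective e))
  have hBmem : ∀ x, x ∈ B ↔ ∃ k, k < p ∧ (σ h ^ k) x₀ = x := by
    intro x; rw [hBdef, Finset.mem_image]; simp only [Finset.mem_range]
  -- every element maps B to B
  have hBinv : ∀ u, ∀ x ∈ B, σ u x ∈ B := by
    intro u x hx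
    obtain ⟨a, b, -, -, rfl⟩ := exists_pow_mul_pow p hg hh hgh u
    obtain ⟨k, -, rfl⟩ := (hBmem x).1 hx
    rw [hσmul, hσpow, hσpow, Equiv.Perm.mul_apply]
    have e1 : (σ h ^ b) ((σ h ^ k) x₀) = (σ h ^ ((b + k) % p)) x₀ := by
      rw [← Equiv.Perm.mul_apply, ← pow_add, pow_eq_pow_mod _ (hσp h)]
    have hcm : Commute (σ g ^ a) (σ h ^ ((b + k) % p)) := (hσcomm g h).pow_pow _ _
    rw [e1, ← Equiv.Perm.mul_apply, hcm.eq, Equiv.Perm.mul_apply, hgxpow a]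
    exact (hBmem _).2 ⟨(b + k) % p, Nat.mod_lt _ hp0, rfl⟩
  -- an element moving x₀ has no fixed point on B
  have hBfpf : ∀ u, σ u x₀ ≠ x₀ → ∀ x ∈ B, σ u x ≠ x := by
    intro u hux x hx heq
    obtain ⟨k, -, rfl⟩ := (hBmem x).1 hx
    have hcm : Commute (σ u) (σ h ^ k) := (hσcomm u h).pow_right k
    rw [← Equiv.Perm.mul_apply, hcm.eq, Equiv.Perm.mul_apply] at heq
    exact hux ((σ h ^ k).injective heq)
  -- Step 3: re-sign with respect to h
  obtain ⟨dh, eh, hSh⟩ := haut h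
  obtain ⟨s, t', hs, ht', hH1, hinv1⟩ := exists_resign_of_odd hH hSh hodd (hσp h) (hσ'p h)
  set H₁ : Matrix ι ι ℤ := Matrix.of fun i j => s i * t' j * H i j with hH₁def
  have hH1aut : ∀ i j, H₁ (σ h i) (σ' h j) = H₁ i j := by
    intro i j; simp only [hH₁def, Matrix.of_apply]; exact hinv1 i j
  have hH1ne : ∀ i j, H₁ i j ≠ 0 := fun i j => pm_ne_zero (hH1.1 i j)
  have hSh' : IsSignedAut H₁ (σ h) (σ' h) (fun _ => 1) (fun _ => 1) :=
    ⟨fun _ => Or.inl rfl, fun _ => Or.inl rfl, fun i j => by rw [hH1aut i j]; ring⟩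
  haveI : Nonempty ι := ⟨x₀⟩
  -- KEY: a column fixed by an element moving x₀ is constant along B
  have hconstcol : ∀ u, σ u x₀ ≠ x₀ → ∀ y, σ' u y = y → ∀ x ∈ B, H₁ x y = H₁ x₀ y := by
    intro u hux y hy
    obtain ⟨d2, e2, hSu⟩ := haut u
    have hSu' : IsSignedAut H₁ (σ u) (σ' u) (fun i => s (σ u i) * d2 i * s i)
        (fun j => t' (σ' u j) * e2 j * t' j) := by
      refine ⟨fun i => ?_, fun j => ?_, fun i j => ?_⟩
      · rcases hs (σ u i) with h1 | h1 <;> rcases hSu.1 i with h2 | h2 <;> rcases hs i with h3 | h3 <;>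
          simp [h1, h2, h3]
      · rcases ht' (σ' u j) with h1 | h1 <;> rcases hSu.2.1 j with h2 | h2 <;> rcases ht' j with h3 | h3 <;>
          simp [h1, h2, h3]
      · simp only [hH₁def, Matrix.of_apply]
        rw [hSu.2.2 i j]
        have hsi : s i * s i = 1 := pm_mul_self (hs i)
        have htj : t' j * t' j = 1 := pm_mul_self (ht' j)
        calc s (σ u i) * t' (σ' u j) * (d2 i * e2 j * H i j)
            = s (σ u i) * t' (σ' u j) * (d2 i * e2 j * H i j) * ((s i * s i) * (t' j * t' j)) := by
              rw [hsi, htj, mul_one, mul_one]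
          _ = s (σ u i) * d2 i * s i * (t' (σ' u j) * e2 j * t' j) * (s i * t' j * H i j) := by ring
    set du : ι → ℤ := fun i => s (σ u i) * d2 i * s i with hdu
    set eu : ι → ℤ := fun j => t' (σ' u j) * e2 j * t' j with heu
    obtain ⟨hdcomm, -⟩ := signedAut_comm_of_odd hH1ne hSh' hSu' (hσcomm h u) (hσ'comm h u)
      hodd (hσp u) (hσ'p u)
    have hdustep : ∀ x ∈ B, du (σ h x) = du x := by
      intro x _; have := hdcomm x; simpa using this.symm
    have hμ : ∀ x ∈ B, du x = du x₀ := by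
      intro x hx
      obtain ⟨k, hk⟩ := exists_pow_apply_eq_prime p (σ h) (hσp h) B hBcard (hBinv h) (hBfpf h hhx') hx₀B hx
      rw [← hk]
      exact apply_pow_eq_of_step (σ h) B (hBinv h) du hdustep hx₀B k
    -- the step along u on B
    have hstep : ∀ x ∈ B, H₁ (σ u x) y = H₁ x y := by
      intro x hx
      have hrel := hSu'.2.2 x y
      rw [hy] at hrel
      have hprod := signedAut_pow hSu' p x₀ y
      rw [hσp u, hσ'p u, Equiv.Perm.one_apply, Equiv.Perm.one_apply] at hprod
      have hcycE : cyc (σ' u) eu y p = eu y := by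
        unfold cyc
        have hfixpow : ∀ l : ℕ, (σ' u ^ l) y = y := by
          intro l; induction l with
          | zero => simp
          | succ l ih => rw [pow_succ', Equiv.Perm.mul_apply, ih, hy]
        rw [Finset.prod_congr rfl (fun l _ => by rw [hfixpow l]), Finset.prod_const, Finset.card_range]
        rcases hSu'.2.1 y with h0 | h0
        · rw [h0, one_pow]
        · rw [h0]; exact hodd.neg_one_pow
      have hcycD : cyc (σ u) du x₀ p = du x₀ := by
        unfold cyc
        have hmemB : ∀ l : ℕ, (σ u ^ l) x₀ ∈ B := by
          intro l; induction l with
          | zero => simpa using hx₀B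
          | succ l ih => rw [pow_succ', Equiv.Perm.mul_apply]; exact hBinv u _ ih
        rw [Finset.prod_congr rfl (fun l _ => hμ _ (hmemB l)), Finset.prod_const, Finset.card_range]
        rcases hSu'.1 x₀ with h0 | h0
        · rw [h0, one_pow]
        · rw [h0]; exact hodd.neg_one_pow
      have hDE : cyc (σ u) du x₀ p * cyc (σ' u) eu y p = 1 := by
        have hne := hH1ne x₀ y
        have : (cyc (σ u) du x₀ p * cyc (σ' u) eu y p - 1) * H₁ x₀ y = 0 := by
          have := hprod; simp only [hdu, heu] at this ⊢; linarith
        rcases mul_eq_zero.mp this with h0 | h0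
        · linarith
        · exact absurd h0 hne
      rw [hcycE, hcycD] at hDE
      have hμx := hμ x hx
      have hμμ : du x₀ * du x₀ = 1 := pm_mul_self (hSu'.1 x₀)
      have hey : eu y = du x₀ := by
        calc eu y = (du x₀ * du x₀) * eu y := by rw [hμμ, one_mul]
          _ = du x₀ * (du x₀ * eu y) := by ring
          _ = du x₀ := by rw [hDE, mul_one]
      rw [hrel]
      show du x * eu y * H₁ x y = H₁ x y
      rw [hμx, hey, hμμ, one_mul]
    intro x hx
    obtain ⟨k, hk⟩ := exists_pow_apply_eq_prime p (σ u) (hσp u) B hBcard (hBinv u) (hBfpf u hux) hx₀B hx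
    rw [← hk]; exact apply_pow_eq_of_step (σ u) B (hBinv u) (fun x => H₁ x y) hstep hx₀B k
  -- Step 4: representatives other than rK move x₀
  have hmove : ∀ r ∈ R, r ≠ rK → σ r x₀ ≠ x₀ := by
    intro r hr hrrK hrx
    have hgoff : g ∉ (Finset.range (p - 1)).image (fun k => r ^ (k + 1)) := by
      intro hgr
      have hdis := disjoint_plines p (lineRep_ne_one p hrK) (rep_not_mem_pline_rep p hr hrK hrrK)
      exact Finset.disjoint_left.mp hdis hgr hgline
    have := fixed_by_all_of_two p α β hα hβ hc {x₀} (lineRep_ne_one p hr) hg hgoff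
      (fun i hi => by rw [Finset.mem_singleton] at hi; rw [hi]; exact hrx)
      (fun i hi => by rw [Finset.mem_singleton] at hi; rw [hi]; exact hgx') h x₀ (Finset.mem_singleton_self _)
    exact hhx' this
  set T := (R.erase rK).biUnion (fun r => univ.filter (fun y => σ' r y = y)) with hTdef
  have hTconst : ∀ y ∈ T, ∀ x ∈ B, H₁ x y = H₁ x₀ y := by
    intro y hy
    rw [hTdef, Finset.mem_biUnion] at hy
    obtain ⟨r, hr, hyr⟩ := hy
    have hr' := Finset.mem_erase.mp hr
    exact hconstcol r (hmove r hr'.2 hr'.1) y (by simpa using hyr)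
  have hbound := card_mul_card_le_of_const_cols hH1 B T x₀ hx₀B hTconst
  rw [hBcard] at hbound; exact hbound

end hadamard

end Summit.Ventures.DiscreteObjects.Hadamard
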